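import Literature.NumberTheory.LFunctions.WeilFirstPrimeOddMarginDataA
import Literature.NumberTheory.LFunctions.WeilBlockRows
import HarnessLib

/-!
# Odd-sector margin certificate A: dominance of rows 25–29 of `R = S'_odd(κ') − UᵀU`

Part of the odd-block check of `weilCertOddA` (`WeilFirstPrimeOddMarginDataA.lean`), evaluated by `decide +kernel`
row by row (`WeilCert.checkDomRow`, `WeilBlockRows.lean`) and kept in its own file for kernel time and memory.
Assembled in `WeilFirstPrimeOddMarginACheck.lean`. Pure proof file; nothing is asserted.
-/

noncomputable section

namespace Literature.NumberTheory.LFunctions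

set_option maxHeartbeats 0 in
/-- Kernel check of the dominance of row 25 of `R = S'_odd(κ') − UᵀU` (certificate A). [folklore] -/
theorem checkDomRow1_25_weilCertOddA :
    weilCertOddA.base.checkDomRow weilCertOddA.nuTab weilCertOddAKappa' 1 25 = true := by
  decide +kernel

set_option maxHeartbeats 0 in
/-- Kernel check of the dominance of row 26 of `R = S'_odd(κ') − UᵀU` (certificate A). [folklore] -/
theorem checkDomRow1_26_weilCertOddA :
    weilCertOddA.base.checkDomRow weilCertOddA.nuTab weilCertOddAKappa' 1 26 = true := by
  decide +kernel

set_option maxHeartbeats 0 in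
/-- Kernel check of the dominance of row 27 of `R = S'_odd(κ') − UᵀU` (certificate A). [folklore] -/
theorem checkDomRow1_27_weilCertOddA :
    weilCertOddA.base.checkDomRow weilCertOddA.nuTab weilCertOddAKappa' 1 27 = true := by
  decide +kernel

set_option maxHeartbeats 0 in
/-- Kernel check of the dominance of row 28 of `R = S'_odd(κ') − UᵀU` (certificate A). [folklore] -/
theorem checkDomRow1_28_weilCertOddA :
    weilCertOddA.base.checkDomRow weilCertOddA.nuTab weilCertOddAKappa' 1 28 = true := by
  decide +kernel

set_option maxHeartbeats 0 in
/-- Kernel check of the dominance of row 29 of `R = S'_odd(κ') − UᵀU` (certificate A). [folklore] -/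
theorem checkDomRow1_29_weilCertOddA :
    weilCertOddA.base.checkDomRow weilCertOddA.nuTab weilCertOddAKappa' 1 29 = true := by
  decide +kernel

end Literature.NumberTheory.LFunctions
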